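import Mathlib.Data.Real.Basic
import Mathlib.Tactic

/-!
# `MultiplicationAccessible` (stmt-KontsevichZagierPeriods-12305), line `shifted-family-prime-sieve`,
stub `stub_oddPrimeShifted` at `p = 3`: kernel-checked certificates of the complementary-modulus structure

The residual of the line is the shifted Gauss-multiplication family `GM(p; x, s)` at odd primes `p`. At
`p = 3`, fibring the box `(t₀,t₁,t₂) ∈ (0,1)³` over `(u′, F) = (t₀t₁t₂, ∏(1−tₖ))` makes `x` and `s` spectators;
in Kummer coordinates `wₖ = tₖ^{1/3}` (`u = w₀w₁w₂`, `u′ = u³`) the permutation group of the coordinates lifts to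
the cyclic triple cover `y³ = t₁²t₂` of the fibre curve, and the quotient by the lifted `S₃` is computed by
Newton's identities. This file certifies the two algebraic identities on which the crux idea card
`Cruxes/MultiplicationAccessible/Ideas/complementary-modulus-transposition.md` rests (both found and
numerically/arithmetically tested by the line lead, 2026-08-16):

* `gmThree_quotientCubic_identity` — with `L = Σ tᵢ − 3u`, `Π = e₁(w)e₂(w)`, `D = (1−u)³ − F` (as polynomials in
  `w`), `Π³ = (3Π + L)(3uΠ + L − D)` identically: the `S₃`-quotient of the cover of the fibre lies on this
  plane cubic;
* `gmThree_triangleForm_identity` — the rational coordinate change `x = (3Π+L)/(3(1−u))`,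
  `y = −(3uΠ+L−D)/(3(1−u))`, `z = −D/(3(1−u))` has `x + y + z = Π` and `xyz = c′(x+y+z)³` with
  `c′ = D/(27(1−u)³) = 1/27 − c`, `c = F/(27(1−u)³)`: the quotient cubic IS the triangle cubic
  `xyz = c′(x+y+z)³` of the simplex side's own pencil, at the COMPLEMENTARY modulus.

Pure polynomial algebra (`ring`, `field_simp`); no definition, no move of the calculus is claimed here.
-/

namespace Summit.KontsevichZagierPeriods.TerasomaMultiplication.MultiplicationAccessible

/-- **Quotient cubic of the `p = 3` fibre.** For all reals `w₀ w₁ w₂` (Kummer coordinates of the box point,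
`u = w₀w₁w₂`, `tᵢ = wᵢ³`, `F = ∏(1 − tᵢ)`), the symmetric data `L = Σ tᵢ − 3u`, `Π = e₁(w)·e₂(w)` and
`D = (1 − u)³ − F` satisfy `Π³ = (3Π + L)(3uΠ + L − D)` — Newton's identities `e₁³ − 3e₁e₂ + 3e₃ = Σ wᵢ³` and
`e₂³ − 3e₂(e₁e₃) + 3e₃² = Σ (wᵢwⱼ)³` multiplied together. [folklore] -/
theorem gmThree_quotientCubic_identity :
    ∀ (w₀ w₁ w₂ : ℝ),
      ((w₀ + w₁ + w₂) * (w₀ * w₁ + w₁ * w₂ + w₂ * w₀)) ^ 3 =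
        (3 * ((w₀ + w₁ + w₂) * (w₀ * w₁ + w₁ * w₂ + w₂ * w₀)) +
            (w₀ ^ 3 + w₁ ^ 3 + w₂ ^ 3 - 3 * (w₀ * w₁ * w₂))) *
          (3 * (w₀ * w₁ * w₂) * ((w₀ + w₁ + w₂) * (w₀ * w₁ + w₁ * w₂ + w₂ * w₀)) +
              (w₀ ^ 3 + w₁ ^ 3 + w₂ ^ 3 - 3 * (w₀ * w₁ * w₂)) -
            ((1 - w₀ * w₁ * w₂) ^ 3 - (1 - w₀ ^ 3) * (1 - w₁ ^ 3) * (1 - w₂ ^ 3))) := by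
  intro w₀ w₁ w₂
  ring

/-- **The quotient cubic is the triangle cubic at the complementary modulus.** With `Π`, `L`, `D`, `u` as
above (here free real variables subject only to the cubic relation and `u ≠ 1`), the points
`x = (3Π+L)/(3(1−u))`, `y = −(3uΠ+L−D)/(3(1−u))`, `z = −D/(3(1−u))` satisfy `x + y + z = Π` and
`x·y·z = c′·(x+y+z)³` with `c′ = D/(27(1−u)³)` — i.e. the cubic `Π³ = (3Π+L)(3uΠ+L−D)` is isomorphic, by a
rational linear change of coordinates, to `xyz = c′(x+y+z)³`; with `D = (1−u)³ − F` one has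
`c′ = 1/27 − F/(27(1−u)³)`. [folklore] -/
theorem gmThree_triangleForm_identity :
    ∀ (P L D u : ℝ), u ≠ 1 → P ^ 3 = (3 * P + L) * (3 * u * P + L - D) →
      (3 * P + L) / (3 * (1 - u)) + (-(3 * u * P + L - D) / (3 * (1 - u))) + (-D / (3 * (1 - u))) = P ∧
      ((3 * P + L) / (3 * (1 - u))) * (-(3 * u * P + L - D) / (3 * (1 - u))) * (-D / (3 * (1 - u))) =
        D / (27 * (1 - u) ^ 3) *
          ((3 * P + L) / (3 * (1 - u)) + (-(3 * u * P + L - D) / (3 * (1 - u))) + (-D / (3 * (1 - u)))) ^ 3 := by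
  intro P L D u hu hP
  have h1 : (1 - u) ≠ 0 := sub_ne_zero.mpr (Ne.symm hu)
  have hsum : (3 * P + L) / (3 * (1 - u)) + (-(3 * u * P + L - D) / (3 * (1 - u))) +
      (-D / (3 * (1 - u))) = P := by
    field_simp
    ring
  have hprod : ((3 * P + L) / (3 * (1 - u))) * (-(3 * u * P + L - D) / (3 * (1 - u))) *
      (-D / (3 * (1 - u))) = D / (27 * (1 - u) ^ 3) * P ^ 3 := by
    rw [hP]
    field_simp
    ring
  exact ⟨hsum, by rw [hsum, hprod]⟩

/-- `c′ = 1/27 − c`: with `D = (1 − u)³ − F`, `D/(27(1−u)³) = 1/27 − F/(27(1−u)³)` (`u ≠ 1`). [folklore] -/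
theorem gmThree_complementaryModulus :
    ∀ (u F : ℝ), u ≠ 1 →
      ((1 - u) ^ 3 - F) / (27 * (1 - u) ^ 3) = 1 / 27 - F / (27 * (1 - u) ^ 3) := by
  intro u F hu
  have h1 : (1 - u) ≠ 0 := sub_ne_zero.mpr (Ne.symm hu)
  field_simp

end Summit.KontsevichZagierPeriods.TerasomaMultiplication.MultiplicationAccessible
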